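import Literature.AlgebraicGeometry.Crystalline.DeRhamColumnsTorsionFree
import Literature.AlgebraicGeometry.Crystalline.DeRhamComplexTorsionFree
import Literature.AlgebraicGeometry.Crystalline.HodgeDeRhamDegeneration
import Literature.Algebra.Homology.StaircaseRetraction
import Literature.AlgebraicGeometry.Crystalline.HuComplexes
import HarnessLib

/-!
# Integral `E₁`-degeneration for `Ω•_{𝒳/W}` and for its staircase images `p^{e}Ω•` under the
# hypotheses of the `p`-adic lifting crux

Let `k` be a field of characteristic `p`, `𝒳/W(k)` a smooth proper model of relative dimension `d`
(`Motives.WittScheme.IsSmoothProperModel d 𝒳`), `Ω• = Crystalline.algebraicDeRhamComplex 𝒳` its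
algebraic de Rham complex, and, for an antitone exponent function `e : ℕ → ℕ`,
`p^{e}Ω• = powImage Ω• p e` the STAIRCASE IMAGE subcomplex `[p^{e 0}𝒪 → p^{e 1}Ω¹ → ⋯]`
(`Algebra/Homology/StaircaseComplexes`); for `e j = (r - j) M` these are the integral complexes
`p^{(r-•)M}Ω•` whose quotients are X. Hu's `p^{r,M}_{r,N}Ω•` (`Crystalline/HuComplexes`,
`Algebra/Homology/StaircasePresentation`), and `e = 0`-like cases give `Ω•` itself.

The named fact `Crystalline.HodgeDeRhamDegeneratesModTorsion` (Deligne 1968, Thm. 5.5 (ii)) says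
that the connecting maps `δ : ℍ^{k₀}(σ≤n₀ Ω•) → ℍ^{k₀+1}(Ω^{n₁}[-n₁])` of the stupid filtration of `Ω•`
have TORSION values. This file proves, sorry-free and with the named fact as a HYPOTHESIS `hdeg`:

* (abstract, `Literature.Algebra.Homology`) **transfer of rational degeneration along a retract up
  to a scalar**: for `ι : K ⟶ L`, `ψ : L ⟶ K` with `ι ≫ ψ = c • 𝟙 K`, `c ≠ 0`, torsion values of the
  connecting maps of `L` give torsion values of those of `K`
  (`stupidFiltration_delta_torsion_of_retract`; naturality `stupidFiltration_delta_naturality` +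
  `HyperExt.map` of `ψⁿ¹ ∘ ιⁿ¹ = c`); the bounded-range induction
  `torsionFree_hyperExt_stupidTruncLE_of_le` (torsion-free `ℍ(σ≤n K)` for `n ≤ N` from vanishing
  connecting maps and torsion-free columns UP TO `N` only — the all-degrees version is
  `StupidFiltrationDegeneration.torsionFree_hyperExt_stupidTruncLE`);
* (geometric) for `𝒳` as above with the crux hypotheses `hO`, `hΩ`, `hdisj` (`Hᵇ(𝒳, 𝒪)`, `Hᵇ(𝒳, Ω¹)`
  free of `p`-torsion; `d ≤ 3 ∨ Ω¹ ≅ 𝒪^d`) and any antitone `e`: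
  `staircase_torsionFree_hyperExt_single` (the columns `(p^{e}Ω•)ʲ ≅ Ωʲ` have torsion-free hyper-Ext
  in the reachable range `j ≤ 1 ∨ 3 < d`, via `StaircaseRetraction.powImageXIso` and
  `Crystalline/DeRhamColumnsTorsionFree`), `staircase_stupidFiltration_delta_torsion` (rational
  degeneration for `p^{e}Ω•`, transferred from `hdeg` along `ι ≫ ψ = p^{e 0}`,
  `StaircaseRetraction`), **`staircase_stupidFiltration_delta_eq_zero`** (`δ = 0` for
  `n₁ ≤ 1 ∨ 3 < d`) and **`staircase_torsionFree_hyperExt_stupidTruncLE`**: `ℍᵏ(𝒳, σ≤n (p^{e}Ω•))` is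
  torsion-free for every `k` and every `n` with `n ≤ 1 ∨ 3 < d` — for `e = (r - •) M` and
  `n = r - 1 ≤ d - 2` this is the torsion-freeness input of the lattice lemmas of the `hu` line of
  crux `FormalLiftingFromClassLifting` (route `HodgeConjecture/PadicSemiregularLift`); the case of
  `Ω•` itself (directly from `hdeg`, no retraction) is `deRham_stupidFiltration_delta_eq_zero`,
  with `deRham_map_singleToStupidTruncLE_injective`, `deRham_map_stupidTruncLEMapOfLE_surjective` and,
  on the `Ω¹`-free branch, `deRham_torsionFree_hyperExt_stupidTruncLE_of_free` (all truncations).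

Sources for the role of these statements: S. Bloch, H. Esnault, M. Kerz, *p-adic deformation of
algebraic cycle classes*, Invent. Math. 195 (2014), Rem. 35 (1)–(2); X. Hu, arXiv:2507.12458, §11.
[folklore] Everything is proved modulo `hdeg`.
-/

noncomputable section

universe w v u

/-! ## Abstract: transfer along a retract up to a scalar; bounded-range torsion-freeness -/

namespace Literature.Algebra.Homology

open CategoryTheory Limits

section Retract

variable {C : Type u} [Category.{v} C] [Abelian C] [HasExt.{w} C] (A : C)
  [hA : ∀ (n : ℤ) (Y : C), HasHyperExt.{w} A ((CochainComplex.singleFunctor C n).obj Y)]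
  {K L : CochainComplex C ℤ} [K.IsStrictlyGE 0] [L.IsStrictlyGE 0]
  (ι : K ⟶ L) (ψ : L ⟶ K) (c : ℤ) (hc : c ≠ 0) (hιψ : ι ≫ ψ = c • 𝟙 K)

include hc hιψ in
/-- **Transfer of rational `E₁`-degeneration along a retract up to a scalar.** Let `ι : K ⟶ L` and
`ψ : L ⟶ K` be morphisms of complexes (strictly in degrees `≥ 0`) with `ι ≫ ψ = c • 𝟙 K`, `c ≠ 0`
(e.g. a staircase image subcomplex `q^{e}L ⊆ L` and its retraction, `StaircaseRetraction`). If every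
connecting map of the stupid filtration of `L` has torsion values on hyper-Ext, then so has every
connecting map of the stupid filtration of `K`: by naturality `(ιⁿ¹)_* (δ_K x) = δ_L ((σ≤n₀ ι)_* x)` is
torsion, and `(ψⁿ¹)_* ∘ (ιⁿ¹)_* = c`. [folklore] -/
theorem stupidFiltration_delta_torsion_of_retract (n₀ n₁ : ℤ) (h : n₀ + 1 = n₁) (k k' : ℤ)
    (hk : k + 1 = k')
    (hrat : ∀ x : HyperExt.{w} A (stupidTruncLE L n₀) k, ∃ m : ℤ, m ≠ 0 ∧
      m • HyperExt.delta (shortExact_stupidFiltration L n₀ n₁ h) k k' hk x = 0)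
    (x : HyperExt.{w} A (stupidTruncLE K n₀) k) :
    ∃ m : ℤ, m ≠ 0 ∧ m • HyperExt.delta (shortExact_stupidFiltration K n₀ n₁ h) k k' hk x = 0 := by
  obtain ⟨m, hm, hmx⟩ := hrat (HyperExt.map (stupidTruncLEMap ι n₀) k x)
  refine ⟨m * c, mul_ne_zero hm hc, ?_⟩
  rw [stupidFiltration_delta_naturality A ι n₀ n₁ h k k' hk x, ← map_zsmul] at hmx
  -- apply `(ψⁿ¹)_*`: `(ψⁿ¹)_* ∘ (ιⁿ¹)_* = ((ι ≫ ψ)ⁿ¹)_* = (c • 𝟙)_* = c`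
  have h2 := congrArg (HyperExt.map ((CochainComplex.singleFunctor C n₁).map (ψ.f n₁)) k') hmx
  rw [map_zero, ← HyperExt.map_comp, ← Functor.map_comp, ← HomologicalComplex.comp_f, hιψ,
    HomologicalComplex.zsmul_f_apply, HomologicalComplex.id_f, Functor.map_zsmul,
    CategoryTheory.Functor.map_id, HyperExt.map_zsmul_id, smul_smul, mul_comm] at h2
  exact h2

include hc hιψ in
/-- **`δ = 0` for a retract up to a scalar of a rationally degenerating complex with torsion-free
column**: under the hypotheses of `stupidFiltration_delta_torsion_of_retract`, if moreover
`HyperExt A Kⁿ¹[-n₁] k'` is torsion-free then the connecting map of `K` in bidegree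
`(n₀ → n₁, k → k')` vanishes. [folklore] -/
theorem stupidFiltration_delta_eq_zero_of_retract (n₀ n₁ : ℤ) (h : n₀ + 1 = n₁) (k k' : ℤ)
    (hk : k + 1 = k')
    (hrat : ∀ x : HyperExt.{w} A (stupidTruncLE L n₀) k, ∃ m : ℤ, m ≠ 0 ∧
      m • HyperExt.delta (shortExact_stupidFiltration L n₀ n₁ h) k k' hk x = 0)
    (htf : ∀ m : ℤ, m ≠ 0 →
      ∀ y : HyperExt.{w} A ((CochainComplex.singleFunctor C n₁).obj (K.X n₁)) k', m • y = 0 → y = 0) :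
    HyperExt.delta (X := A) (shortExact_stupidFiltration K n₀ n₁ h) k k' hk = 0 :=
  stupidFiltration_delta_eq_zero A K n₀ n₁ h k k' hk
    (stupidFiltration_delta_torsion_of_retract A ι ψ c hc hιψ n₀ n₁ h k k' hk hrat) htf

end Retract

section Bounded

variable {C : Type u} [Category.{v} C] [Abelian C] [HasExt.{w} C] (A : C)
  [hA : ∀ (n : ℤ) (Y : C), HasHyperExt.{w} A ((CochainComplex.singleFunctor C n).obj Y)]
  (K : CochainComplex C ℤ) [K.IsStrictlyGE 0]

/-- **Torsion-freeness along the stupid filtration, up to a level `N`.** If the connecting maps of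
the stupid filtration of `K` vanish on hyper-Ext in the steps `n₀ → n₁` with `n₁ ≤ N` and the column
groups `HyperExt A Kⁿ[-n] k` are torsion-free for `n ≤ N`, then `HyperExt A (σ≤n K) k` is torsion-free
for every `n ≤ N` and every `k` (the induction of
`StupidFiltrationDegeneration.torsionFree_hyperExt_stupidTruncLE`, run up to `N` only: beyond `N`
nothing is assumed). [folklore] -/
theorem torsionFree_hyperExt_stupidTruncLE_of_le (N : ℤ)
    (hδ : ∀ (n₀ n₁ : ℤ) (h : n₀ + 1 = n₁) (k k' : ℤ) (hk : k + 1 = k'), n₁ ≤ N →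
      HyperExt.delta (X := A) (shortExact_stupidFiltration K n₀ n₁ h) k k' hk = 0)
    (htf : ∀ (n k m : ℤ), n ≤ N → m ≠ 0 →
      ∀ x : HyperExt.{w} A ((CochainComplex.singleFunctor C n).obj (K.X n)) k, m • x = 0 → x = 0)
    (n k m : ℤ) (hn : n ≤ N) (hm : m ≠ 0) (x : HyperExt.{w} A (stupidTruncLE K n) k)
    (hx : m • x = 0) : x = 0 := by
  revert k m
  refine stupidFiltration_induction (P := fun n => n ≤ N → ∀ (k m : ℤ), m ≠ 0 →
    ∀ x : HyperExt.{w} A (stupidTruncLE K n) k, m • x = 0 → x = 0) ?_ ?_ n hn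
  · intro n hn _ k m _ x _
    exact hyperExt_stupidTruncLE_eq_zero_of_neg A K n hn k x
  · intro n₀ n₁ h ih hn₁ k
    exact torsionFree_of_exact_of_exact
      (HyperExt.exact₁_apply A (shortExact_stupidFiltration K n₀ n₁ h) (k - 1) k (by omega))
      (HyperExt.exact₂_apply A (shortExact_stupidFiltration K n₀ n₁ h) k)
      (fun w => by rw [hδ n₀ n₁ h (k - 1) k (by omega) hn₁, AddMonoidHom.zero_apply])
      (fun m hm y hy => htf n₁ k m hn₁ hm y hy) (ih (by omega) k)

end Bounded

end Literature.Algebra.Homology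

/-! ## Geometric: `Ω•_{𝒳/W}` and its staircase images -/

namespace Literature.AlgebraicGeometry.Crystalline

open CategoryTheory CategoryTheory.Limits _root_.AlgebraicGeometry _root_.TopologicalSpace
open Literature.AlgebraicGeometry.Motives Literature.AlgebraicGeometry.Motives.WittScheme
open Literature.Algebra.Homology

-- as in `Crystalline/HodgeDeRhamDegeneration`: `HasHyperExt` for the truncations needs a larger budget
set_option synthInstance.maxHeartbeats 200000

variable {p : ℕ} [Fact p.Prime] {k : Type} [Field k] [CharP k p] {d : ℕ}
  (𝒳 : SchemeOver (WittVector p k)) {e : ℕ → ℕ} (he : Antitone e)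

/-- **The columns of a staircase image `p^{e}Ω•` have torsion-free hyper-Ext in the reachable
range.** For `𝒳/W(k)` a smooth proper model of relative dimension `d` with the crux hypotheses
`hO`, `hΩ`, `hdisj`: `(p^{e}Ω•)ʲ ≅ Ωʲ` (the image of the MONOMORPHISM `p^{e j}`,
`StaircaseRetraction.powImageXIso`, `Ωʲ_𝒳` being `p`-torsion free), so for `m ≠ 0` and `n ≤ 1 ∨ 3 < d`
the group `HyperExt ℤ (p^{e}Ω•)ⁿ[-n] k` has no `m`-torsion (`Crystalline/DeRhamColumnsTorsionFree`).
[folklore] -/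
theorem staircase_torsionFree_hyperExt_single
    [hA : ∀ (n : ℤ) (Y : Sheaf (Opens.grothendieckTopology 𝒳.left) AddCommGrpCat.{0}),
      HasHyperExt.{0} (constantSheafInt (Opens.grothendieckTopology 𝒳.left))
        ((CochainComplex.singleFunctor _ n).obj Y)]
    (h𝒳 : IsSmoothProperModel d 𝒳)
    (hO : ∀ (b : ℕ) (x : structureSheafCohomology 𝒳.left b), (p : ℤ) • x = 0 → x = 0)
    (hΩ : ∀ (b : ℕ) (x : hodgeCohomologyOne 𝒳 b), (p : ℤ) • x = 0 → x = 0)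
    (hdisj : d ≤ 3 ∨ Nonempty (cotangentSheaf 𝒳 ≅
      SheafOfModules.free (R := 𝒳.left.ringCatSheaf) (Fin d)))
    {m : ℤ} (hm : m ≠ 0) (n k₀ : ℤ) (hn : n ≤ 1 ∨ 3 < d)
    (x : HyperExt.{0} (constantSheafInt (Opens.grothendieckTopology 𝒳.left))
      ((CochainComplex.singleFunctor _ n).obj
        (((powImage (algebraicDeRhamComplex 𝒳) (p : ℤ) he).extend
          ComplexShape.embeddingUpNat).X n)) k₀)
    (hx : m • x = 0) : x = 0 := by
  refine torsionFree_hyperExt_single_extend _ (powImage (algebraicDeRhamComplex 𝒳) (p : ℤ) he)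
    (fun (n _ : ℤ) => n ≤ 1 ∨ 3 < d) m (fun j b hj y hy => ?_) n k₀ hn x hx
  haveI := IsSmoothProperModel.mono_p_smul_id_algebraicDeRhamComplex_X 𝒳 d h𝒳 j
  have htf := torsionFree_H_algebraicDeRhamComplex_X_of_pTorsionFree 𝒳 j b
    (H_algebraicDeRhamComplex_X_torsionFree_of_hypotheses 𝒳 hdisj hO hΩ j b
      (by rcases hj with hj | hj <;> [left; right] <;> omega)) hm
  exact Ext.torsionFree_of_iso (powImageXIso (algebraicDeRhamComplex 𝒳) (p : ℤ) he j).symm htf y hy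

/-- **Rational degeneration for the staircase images**: granted Deligne's degeneration modulo
torsion for `Ω•_{𝒳/W}` (`hdeg`), every connecting map of the stupid filtration of `p^{e}Ω•` has
torsion values — transfer along the inclusion `ι : p^{e}Ω• ⟶ Ω•` and the retraction `ψ` with
`ι ≫ ψ = p^{e 0} • 𝟙` (`StaircaseRetraction`). [cite: Deligne1968, Thm. 5.5 (ii)] -/
theorem staircase_stupidFiltration_delta_torsion (hdeg : HodgeDeRhamDegeneratesModTorsion)
    [hA : ∀ (n : ℤ) (Y : Sheaf (Opens.grothendieckTopology 𝒳.left) AddCommGrpCat.{0}),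
      HasHyperExt.{0} (constantSheafInt (Opens.grothendieckTopology 𝒳.left))
        ((CochainComplex.singleFunctor _ n).obj Y)]
    (h𝒳 : IsSmoothProperModel d 𝒳) (n₀ n₁ : ℤ) (h : n₀ + 1 = n₁) (k₀ k₁ : ℤ) (hk : k₀ + 1 = k₁)
    (x : HyperExt.{0} (constantSheafInt (Opens.grothendieckTopology 𝒳.left))
      (stupidTruncLE ((powImage (algebraicDeRhamComplex 𝒳) (p : ℤ) he).extend
        ComplexShape.embeddingUpNat) n₀) k₀) :
    ∃ m : ℤ, m ≠ 0 ∧ m • HyperExt.delta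
      (shortExact_stupidFiltration ((powImage (algebraicDeRhamComplex 𝒳) (p : ℤ) he).extend
        ComplexShape.embeddingUpNat) n₀ n₁ h) k₀ k₁ hk x = 0 :=
  stupidFiltration_delta_torsion_of_retract _
    (HomologicalComplex.extendMap (powImageι (algebraicDeRhamComplex 𝒳) (p : ℤ) he)
      ComplexShape.embeddingUpNat)
    (HomologicalComplex.extendMap (powImageRetraction (algebraicDeRhamComplex 𝒳) (p : ℤ) he)
      ComplexShape.embeddingUpNat)
    ((p : ℤ) ^ e 0) (pow_ne_zero _ (by exact_mod_cast (Fact.out : p.Prime).ne_zero))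
    (extendMap_powImageι_comp_extendMap_powImageRetraction (algebraicDeRhamComplex 𝒳) (p : ℤ) he)
    n₀ n₁ h k₀ k₁ hk (fun y => hdeg p k d 𝒳 h𝒳 n₀ n₁ h k₀ k₁ hk y) x

/-- **Integral `E₁`-degeneration for the staircase images `p^{e}Ω•` in the reachable columns.**
Granted `hdeg`, for `𝒳/W(k)` smooth proper of relative dimension `d` with the crux hypotheses, the
connecting map `δ : ℍ^{k₀}(σ≤n₀ (p^{e}Ω•)) → ℍ^{k₁}((p^{e}Ω•)^{n₁}[-n₁])` vanishes whenever
`n₁ ≤ 1 ∨ 3 < d`. [cite: Deligne1968, Thm. 5.5 (ii)] -/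
theorem staircase_stupidFiltration_delta_eq_zero (hdeg : HodgeDeRhamDegeneratesModTorsion)
    [hA : ∀ (n : ℤ) (Y : Sheaf (Opens.grothendieckTopology 𝒳.left) AddCommGrpCat.{0}),
      HasHyperExt.{0} (constantSheafInt (Opens.grothendieckTopology 𝒳.left))
        ((CochainComplex.singleFunctor _ n).obj Y)]
    (h𝒳 : IsSmoothProperModel d 𝒳)
    (hO : ∀ (b : ℕ) (x : structureSheafCohomology 𝒳.left b), (p : ℤ) • x = 0 → x = 0)
    (hΩ : ∀ (b : ℕ) (x : hodgeCohomologyOne 𝒳 b), (p : ℤ) • x = 0 → x = 0)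
    (hdisj : d ≤ 3 ∨ Nonempty (cotangentSheaf 𝒳 ≅
      SheafOfModules.free (R := 𝒳.left.ringCatSheaf) (Fin d)))
    (n₀ n₁ : ℤ) (h : n₀ + 1 = n₁) (k₀ k₁ : ℤ) (hk : k₀ + 1 = k₁) (hn : n₁ ≤ 1 ∨ 3 < d) :
    HyperExt.delta (X := constantSheafInt (Opens.grothendieckTopology 𝒳.left))
      (shortExact_stupidFiltration ((powImage (algebraicDeRhamComplex 𝒳) (p : ℤ) he).extend
        ComplexShape.embeddingUpNat) n₀ n₁ h) k₀ k₁ hk = 0 :=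
  stupidFiltration_delta_eq_zero _ _ n₀ n₁ h k₀ k₁ hk
    (staircase_stupidFiltration_delta_torsion 𝒳 he hdeg h𝒳 n₀ n₁ h k₀ k₁ hk)
    (fun _ hm x hx => staircase_torsionFree_hyperExt_single 𝒳 he h𝒳 hO hΩ hdisj hm n₁ k₁ hn x hx)

/-- **Torsion-free hypercohomology of the truncations of the staircase images.** Granted `hdeg`,
for `𝒳/W(k)` smooth proper of relative dimension `d` with the crux hypotheses and any antitone `e`,
`ℍᵏ(𝒳, σ≤n (p^{e}Ω•))` has no `m`-torsion (`m ≠ 0`) for every `k` and every `n` with `n ≤ 1 ∨ 3 < d`.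
For `e = (r - •) M` and `n = r - 1` (`1 ≤ r < d`, so `r - 1 ≤ d - 2`) this is the torsion-freeness of
`ℍ^{2r}(σ≤(r-1) (p^{(r-•)M}Ω•))` consumed by the lattice lemmas of the `hu` line of the crux
`FormalLiftingFromClassLifting`. [cite: Deligne1968, Thm. 5.5 (ii)] -/
theorem staircase_torsionFree_hyperExt_stupidTruncLE (hdeg : HodgeDeRhamDegeneratesModTorsion)
    [hA : ∀ (n : ℤ) (Y : Sheaf (Opens.grothendieckTopology 𝒳.left) AddCommGrpCat.{0}),
      HasHyperExt.{0} (constantSheafInt (Opens.grothendieckTopology 𝒳.left))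
        ((CochainComplex.singleFunctor _ n).obj Y)]
    (h𝒳 : IsSmoothProperModel d 𝒳)
    (hO : ∀ (b : ℕ) (x : structureSheafCohomology 𝒳.left b), (p : ℤ) • x = 0 → x = 0)
    (hΩ : ∀ (b : ℕ) (x : hodgeCohomologyOne 𝒳 b), (p : ℤ) • x = 0 → x = 0)
    (hdisj : d ≤ 3 ∨ Nonempty (cotangentSheaf 𝒳 ≅
      SheafOfModules.free (R := 𝒳.left.ringCatSheaf) (Fin d)))
    (n k₀ m : ℤ) (hn : n ≤ 1 ∨ 3 < d) (hm : m ≠ 0)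
    (x : HyperExt.{0} (constantSheafInt (Opens.grothendieckTopology 𝒳.left))
      (stupidTruncLE ((powImage (algebraicDeRhamComplex 𝒳) (p : ℤ) he).extend
        ComplexShape.embeddingUpNat) n) k₀)
    (hx : m • x = 0) : x = 0 := by
  -- run the bounded induction up to `N = n`
  refine torsionFree_hyperExt_stupidTruncLE_of_le _ _ n (fun n₀ n₁ h k k' hk hn₁ => ?_)
    (fun n' k' m' hn' hm' y hy => ?_) n k₀ m le_rfl hm x hx
  · exact staircase_stupidFiltration_delta_eq_zero 𝒳 he hdeg h𝒳 hO hΩ hdisj n₀ n₁ h k k' hk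
      (by rcases hn with hn | hn <;> [left; right] <;> omega)
  · exact staircase_torsionFree_hyperExt_single 𝒳 he h𝒳 hO hΩ hdisj hm' n' k'
      (by rcases hn with hn | hn <;> [left; right] <;> omega) y hy

/-- **The weight-`r` form** (the shape consumed by the lattice lemmas of the `hu` line): granted
`hdeg`, for `𝒳/W(k)` smooth proper of relative dimension `d` with the crux hypotheses, `r < d`
and any `M`, the hypercohomology `ℍᵏ(𝒳, σ≤(r-1) (p^{(r-•)M}Ω•))` of the truncation below `r` of the
integral staircase complex `p^{(r-•)M}Ω• = powImage Ω• p ((r-•)M)` (`Crystalline.antitone_staircase`)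
has no `m`-torsion for `m ≠ 0` (as `r - 1 ≤ d - 2`, the columns involved are reachable:
`r - 1 ≤ 1` when `d ≤ 3`). [cite: Deligne1968, Thm. 5.5 (ii)] -/
theorem staircase_torsionFree_hyperExt_stupidTruncLE_weight
    (hdeg : HodgeDeRhamDegeneratesModTorsion)
    [hA : ∀ (n : ℤ) (Y : Sheaf (Opens.grothendieckTopology 𝒳.left) AddCommGrpCat.{0}),
      HasHyperExt.{0} (constantSheafInt (Opens.grothendieckTopology 𝒳.left))
        ((CochainComplex.singleFunctor _ n).obj Y)]
    (h𝒳 : IsSmoothProperModel d 𝒳)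
    (hO : ∀ (b : ℕ) (x : structureSheafCohomology 𝒳.left b), (p : ℤ) • x = 0 → x = 0)
    (hΩ : ∀ (b : ℕ) (x : hodgeCohomologyOne 𝒳 b), (p : ℤ) • x = 0 → x = 0)
    (hdisj : d ≤ 3 ∨ Nonempty (cotangentSheaf 𝒳 ≅
      SheafOfModules.free (R := 𝒳.left.ringCatSheaf) (Fin d)))
    (r M : ℕ) (hrd : r < d) (k₀ m : ℤ) (hm : m ≠ 0)
    (x : HyperExt.{0} (constantSheafInt (Opens.grothendieckTopology 𝒳.left))
      (stupidTruncLE ((powImage (algebraicDeRhamComplex 𝒳) (p : ℤ) (antitone_staircase r M)).extend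
        ComplexShape.embeddingUpNat) ((r : ℤ) - 1)) k₀)
    (hx : m • x = 0) : x = 0 :=
  staircase_torsionFree_hyperExt_stupidTruncLE 𝒳 (antitone_staircase r M) hdeg h𝒳 hO hΩ hdisj
    ((r : ℤ) - 1) k₀ m (by rcases Nat.lt_or_ge 3 d with hd | hd <;> [right; left] <;> omega) hm x hx

/-! ### The de Rham complex itself -/

/-- **Integral `E₁`-degeneration for `Ω•_{𝒳/W}` in the reachable columns.** Granted Deligne's
degeneration modulo torsion (`hdeg : HodgeDeRhamDegeneratesModTorsion`), for a smooth proper model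
`𝒳/W(k)` of relative dimension `d` whose `Hᵇ(𝒳, 𝒪)`, `Hᵇ(𝒳, Ω¹)` have no `p`-torsion and with
`d ≤ 3 ∨ Ω¹ ≅ 𝒪^d`, the connecting map
`δ : ℍ^{k₀}(σ≤n₀ Ω•) → ℍ^{k₁}(Ω^{n₁}[-n₁])` (`n₀ + 1 = n₁`, `k₀ + 1 = k₁`) of the stupid filtration of
the de Rham complex vanishes whenever `n₁ ≤ 1 ∨ 3 < d` (torsion values into a torsion-free group).
[cite: Deligne1968, Thm. 5.5 (ii)] -/
theorem deRham_stupidFiltration_delta_eq_zero (hdeg : HodgeDeRhamDegeneratesModTorsion)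
    [hA : ∀ (n : ℤ) (Y : Sheaf (Opens.grothendieckTopology 𝒳.left) AddCommGrpCat.{0}),
      HasHyperExt.{0} (constantSheafInt (Opens.grothendieckTopology 𝒳.left))
        ((CochainComplex.singleFunctor _ n).obj Y)]
    (h𝒳 : IsSmoothProperModel d 𝒳)
    (hO : ∀ (b : ℕ) (x : structureSheafCohomology 𝒳.left b), (p : ℤ) • x = 0 → x = 0)
    (hΩ : ∀ (b : ℕ) (x : hodgeCohomologyOne 𝒳 b), (p : ℤ) • x = 0 → x = 0)
    (hdisj : d ≤ 3 ∨ Nonempty (cotangentSheaf 𝒳 ≅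
      SheafOfModules.free (R := 𝒳.left.ringCatSheaf) (Fin d)))
    (n₀ n₁ : ℤ) (h : n₀ + 1 = n₁) (k₀ k₁ : ℤ) (hk : k₀ + 1 = k₁) (hn : n₁ ≤ 1 ∨ 3 < d) :
    HyperExt.delta (X := constantSheafInt (Opens.grothendieckTopology 𝒳.left))
      (shortExact_stupidFiltration ((algebraicDeRhamComplex 𝒳).extend ComplexShape.embeddingUpNat)
        n₀ n₁ h) k₀ k₁ hk = 0 :=
  stupidFiltration_delta_eq_zero _ _ n₀ n₁ h k₀ k₁ hk
    (fun x => hdeg p k d 𝒳 h𝒳 n₀ n₁ h k₀ k₁ hk x)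
    (fun _ hm x hx => torsionFree_hyperExt_single_deRham_of_hypotheses 𝒳 hO hΩ hdisj hm n₁ k₁ hn x hx)

/-- In the reachable columns, `ℍᵏ(Ω^{n₁}[-n₁]) → ℍᵏ(σ≤n₁ Ω•)` is injective (granted `hdeg`).
[cite: Deligne1968, Thm. 5.5 (ii)] -/
theorem deRham_map_singleToStupidTruncLE_injective (hdeg : HodgeDeRhamDegeneratesModTorsion)
    [hA : ∀ (n : ℤ) (Y : Sheaf (Opens.grothendieckTopology 𝒳.left) AddCommGrpCat.{0}),
      HasHyperExt.{0} (constantSheafInt (Opens.grothendieckTopology 𝒳.left))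
        ((CochainComplex.singleFunctor _ n).obj Y)]
    (h𝒳 : IsSmoothProperModel d 𝒳)
    (hO : ∀ (b : ℕ) (x : structureSheafCohomology 𝒳.left b), (p : ℤ) • x = 0 → x = 0)
    (hΩ : ∀ (b : ℕ) (x : hodgeCohomologyOne 𝒳 b), (p : ℤ) • x = 0 → x = 0)
    (hdisj : d ≤ 3 ∨ Nonempty (cotangentSheaf 𝒳 ≅
      SheafOfModules.free (R := 𝒳.left.ringCatSheaf) (Fin d)))
    (n₀ n₁ : ℤ) (h : n₀ + 1 = n₁) (k₁ : ℤ) (hn : n₁ ≤ 1 ∨ 3 < d) :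
    Function.Injective (HyperExt.map (X := constantSheafInt (Opens.grothendieckTopology 𝒳.left))
      (singleToStupidTruncLE ((algebraicDeRhamComplex 𝒳).extend ComplexShape.embeddingUpNat) n₁)
        k₁) :=
  map_singleToStupidTruncLE_injective _ _ n₀ n₁ h (k₁ - 1) k₁ (by omega)
    (deRham_stupidFiltration_delta_eq_zero 𝒳 hdeg h𝒳 hO hΩ hdisj n₀ n₁ h _ _ _ hn)

/-- In the reachable columns, `ℍᵏ(σ≤n₁ Ω•) → ℍᵏ(σ≤n₀ Ω•)` is surjective (granted `hdeg`).
[cite: Deligne1968, Thm. 5.5 (ii)] -/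
theorem deRham_map_stupidTruncLEMapOfLE_surjective (hdeg : HodgeDeRhamDegeneratesModTorsion)
    [hA : ∀ (n : ℤ) (Y : Sheaf (Opens.grothendieckTopology 𝒳.left) AddCommGrpCat.{0}),
      HasHyperExt.{0} (constantSheafInt (Opens.grothendieckTopology 𝒳.left))
        ((CochainComplex.singleFunctor _ n).obj Y)]
    (h𝒳 : IsSmoothProperModel d 𝒳)
    (hO : ∀ (b : ℕ) (x : structureSheafCohomology 𝒳.left b), (p : ℤ) • x = 0 → x = 0)
    (hΩ : ∀ (b : ℕ) (x : hodgeCohomologyOne 𝒳 b), (p : ℤ) • x = 0 → x = 0)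
    (hdisj : d ≤ 3 ∨ Nonempty (cotangentSheaf 𝒳 ≅
      SheafOfModules.free (R := 𝒳.left.ringCatSheaf) (Fin d)))
    (n₀ n₁ : ℤ) (h : n₀ + 1 = n₁) (k₀ : ℤ) (hn : n₁ ≤ 1 ∨ 3 < d) :
    Function.Surjective (HyperExt.map (X := constantSheafInt (Opens.grothendieckTopology 𝒳.left))
      (stupidTruncLEMapOfLE ((algebraicDeRhamComplex 𝒳).extend ComplexShape.embeddingUpNat) n₀ n₁
        (by omega)) k₀) :=
  map_stupidTruncLEMapOfLE_surjective _ _ n₀ n₁ h k₀ (k₀ + 1) rfl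
    (deRham_stupidFiltration_delta_eq_zero 𝒳 hdeg h𝒳 hO hΩ hdisj n₀ n₁ h _ _ _ hn)

/-- **The `Ω¹`-free branch: all truncations have torsion-free hypercohomology.** Granted `hdeg`, for
`𝒳/W(k)` smooth proper of relative dimension `d > 3` with `Ω¹_{𝒳/W} ≅ 𝒪^d` and `Hᵇ(𝒳, 𝒪)` free of
`p`-torsion (then so are all `Hᵇ(𝒳, Ωʲ)`), every `ℍᵏ(𝒳, σ≤n Ω•)` is torsion-free.
[cite: Deligne1968, Thm. 5.5 (ii)] -/
theorem deRham_torsionFree_hyperExt_stupidTruncLE_of_free (hdeg : HodgeDeRhamDegeneratesModTorsion)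
    [hA : ∀ (n : ℤ) (Y : Sheaf (Opens.grothendieckTopology 𝒳.left) AddCommGrpCat.{0}),
      HasHyperExt.{0} (constantSheafInt (Opens.grothendieckTopology 𝒳.left))
        ((CochainComplex.singleFunctor _ n).obj Y)]
    (h𝒳 : IsSmoothProperModel d 𝒳) (hd : 3 < d)
    (hO : ∀ (b : ℕ) (x : structureSheafCohomology 𝒳.left b), (p : ℤ) • x = 0 → x = 0)
    (hfree : Nonempty (cotangentSheaf 𝒳 ≅ SheafOfModules.free (R := 𝒳.left.ringCatSheaf) (Fin d)))
    (n k₀ m : ℤ) (hm : m ≠ 0)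
    (x : HyperExt.{0} (constantSheafInt (Opens.grothendieckTopology 𝒳.left))
      (stupidTruncLE ((algebraicDeRhamComplex 𝒳).extend ComplexShape.embeddingUpNat) n) k₀)
    (hx : m • x = 0) : x = 0 := by
  have hΩ : ∀ (b : ℕ) (x : hodgeCohomologyOne 𝒳 b), (p : ℤ) • x = 0 → x = 0 := by
    intro b y hy
    -- `Ω¹ = (Ω•)¹` and on the free branch `(Ω•)¹ ≅ 𝒪^d`
    apply (hOneAddEquiv 𝒳 b).symm.injective
    rw [map_zero]
    exact H_algebraicDeRhamComplex_X_torsionFree_of_cotangentSheaf_free 𝒳 hfree.some (hO b) 1 _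
      (by rw [← map_zsmul, hy, map_zero])
  exact torsionFree_hyperExt_stupidTruncLE _ _
    (fun n₀ n₁ h k k' hk => deRham_stupidFiltration_delta_eq_zero 𝒳 hdeg h𝒳 hO hΩ (Or.inr hfree)
      n₀ n₁ h k k' hk (Or.inr hd))
    (fun n' k' m' hm' y hy => torsionFree_hyperExt_single_deRham_of_hypotheses 𝒳 hO hΩ (Or.inr hfree)
      hm' n' k' (Or.inr hd) y hy)
    n k₀ m hm x hx

end Literature.AlgebraicGeometry.Crystalline

end
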